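import Summits.CriticalPhenomena.PercolationContinuityZ3.Theorems.PercNearOneGluingNoHeavyLowerTailHullPortTACE
import Summits.CriticalPhenomena.PercolationContinuityZ3.Theorems.PercNearOneGluingNoHeavyLowerTailCovTauConsequences
import HarnessLib

/-!
# COV(τ) IS MDL(X): the conditioned covariance transfer, (S5)₂,
# (GEN) for three relays and Kozma–Nitzan's Conjecture 1 for `|A| = 3`, UNCONDITIONALLY, from the `T_A` chain

OBSERVATION.  The conditioned covariance transfer

  COV(τ):  `Cov(f(C_x), 1{x ↔ o} | x ↮ y) ≥ μ(v ↔ o | v ↮ x, v ↮ y) · Cov(f(C_x), 1{x ↔ v} | x ↮ y)`   (`f` monotone),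

is LITERALLY the functional marker dominance lemma MDL(X) of the `HullPort` files under the dictionary
`(s, X, y, z) := (x, {y}, v, o)`:
`Cov_{s↮X}(F(C_s), 1{s↔z}) ≥ μ(y↔z | y ↮ X ∪ {s}) · Cov_{s↮X}(F(C_s), 1{s↔y})`.  Moreover the single hypothesis of the
chain `CovTau.covTau_of_diagonal` / `CovTau.kn_conj1_three_of_diagonal` (the "A2-diagonal"
`E·∫_D Cov_{p^ω} ≤ M·∫_D q_ω·Cov_{p^ω}`) is `M · T_A ≥ 0` with `T_A = Σ_K μ(C_X = K)(r_K − r)·c_K` — functional,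
whose nonnegativity is `HullPort.taQ_nonneg_of_PvI` (double induction on `(|V∖X|, #boundary pairs)` with the
one-edge Bernstein identity) fed by Lemma P_v (`HullPort.PvI_of_CE` + `HullPort.CE_holds`, Gladkov's
decision-tree Harris inequality for the cluster exploration).  So nothing is left to assume:

* `CovTau.ta_nonneg` — `T_A ≥ 0` for all `(s, y, z, X)`, all non-degenerate weights, all monotone `g ≥ 0` (hypothesis `hTA` of
  `HullPort.markerDominanceAvoid_of_TA`, proved).
* `CovTau.markerDominanceAvoid` — MDL(X) for every finite avoided set `X` and every monotone `F` (no hypothesis).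
* `CovTau.covTau` — COV(τ), verbatim the conclusion of `CovTau.covTau_of_diagonal`, with NO hypothesis.
* `CovTau.covTransfer`, `CovTau.surplusTransfer_pair` ((S5)₂), `CovTau.gen_triple` ((GEN), three relays),
  `CovTau.kn_conj1_three` (Kozma–Nitzan's Conjecture 1 for three relays) — the reductions
  `CovTau.covTransfer_of_covTau`, `SurplusTransfer.surplusTransfer_pair_of_covTransfer`,
  `SurplusTransfer.gen_triple_of_covTransfer` applied to `CovTau.covTau`.

(A second, independent proof of the same inequality — (★_N) + two-source Lemma A2 by an Ahlswede–Daykin induction,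
files `…CovTauA2*`, `…CovTauStarN*` — also starts from Gladkov's Theorem 3.2.)
[cite: VandenbergHaggstromKahn2005, Thms. 1.3–1.5 (pp. 6–8), §2.1 (pp. 9–13)] [cite: KozmaNitzan2024, Conj. 1 (p. 3), Conj. 4 (p. 32)]
[cite: Gladkov2024, Thm. 3.2]
-/

noncomputable section

namespace Summit.CriticalPhenomena.PercolationContinuityZ3.Theorems

open MeasureTheory Set Literature.Probability.LatticeModels Literature.Probability.Percolation
open scoped Classical

namespace CovTau

variable {V : Type*} [Fintype V]

/-- **`T_A ≥ 0`, unconditionally** (K-decomposition functional of the marker dominance lemma; owner `s`, avoided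
set `X`, markers `y, z`; all non-degenerate weights `p`, all monotone `g ≥ 0`) — exactly the hypothesis `hTA` of
`HullPort.markerDominanceAvoid_of_TA`, proved by `HullPort.TA_of_PvI` + `HullPort.PvI_of_CE` + `HullPort.CE_holds`.
[cite: Gladkov2024, Thm. 3.2] [cite: VandenbergHaggstromKahn2005, Thm. 1.3 (p. 6)] -/
theorem ta_nonneg (s y z : V) (X : Set V) (hsy : s ≠ y) :
    ∀ p : Sym2 V → unitInterval, (∀ e, 0 < p e ∧ p e < 1) →
      ∀ g : Set (Sym2 V) → ℝ, Monotone g → (∀ C, 0 ≤ g C) →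
      0 ≤ ∫ ω in {ω : BondConfig V | ∀ x ∈ X, ¬ (openGraph ω).Reachable s x},
        ((prodBernoulli p).real {ω' : BondConfig V | ∀ x ∈ insert s X, ¬ (openGraph ω').Reachable y x} *
              ((prodBernoulli p).real ((· \ {e : Sym2 V | ∃ v ∈ e, ∃ x ∈ X, (openGraph ω).Reachable x v}) ⁻¹'
                  ((openConn s y : Set (BondConfig V))ᶜ ∩ openConn y z)) /
                (prodBernoulli p).real ((· \ {e : Sym2 V | ∃ v ∈ e, ∃ x ∈ X, (openGraph ω).Reachable x v}) ⁻¹'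
                  ((openConn s y : Set (BondConfig V))ᶜ))) -
            (prodBernoulli p).real ({ω' : BondConfig V | ∀ x ∈ insert s X, ¬ (openGraph ω').Reachable y x} ∩
              openConn y z)) *
          ((∫ η in (· \ {e : Sym2 V | ∃ v ∈ e, ∃ x ∈ X, (openGraph ω).Reachable x v}) ⁻¹'
                (openConn s y : Set (BondConfig V)),
                g (openEdgeCluster (η \ {e : Sym2 V | ∃ v ∈ e, ∃ x ∈ X, (openGraph ω).Reachable x v}) s)
                ∂(prodBernoulli p)) -
            (∫ η, g (openEdgeCluster (η \ {e : Sym2 V | ∃ v ∈ e, ∃ x ∈ X, (openGraph ω).Reachable x v}) s)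
              ∂(prodBernoulli p)) *
              (prodBernoulli p).real ((· \ {e : Sym2 V | ∃ v ∈ e, ∃ x ∈ X, (openGraph ω).Reachable x v}) ⁻¹'
                (openConn s y : Set (BondConfig V))))
        ∂(prodBernoulli p) :=
  HullPort.TA_of_PvI s y z X hsy
    (HullPort.PvI_of_CE s y hsy (fun U hU q _ v => HullPort.CE_holds s y U hU q v))

/-- **MDL(X), unconditionally** — the functional marker dominance lemma with an avoided set: for the owner `s`, a finite
avoided set `X`, markers `y ≠ s` and `z`, and every monotone `F` of the open edge cluster of `s`,
`μ(y ↮ X∪{s}, y ↔ z) · cov_D(F, 1{s↔y}) ≤ μ(y ↮ X∪{s}) · cov_D(F, 1{s↔z})`, `D = {s ↮ X}`,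
`cov_D(F, 1_A) = μ(D) ∫_{D∩A} F − (∫_D F) μ(D∩A)`.  (`HullPort.markerDominanceAvoid_of_TA` + `ta_nonneg`.)
[cite: VandenbergHaggstromKahn2005, §2.1 (pp. 9–13)] [cite: Gladkov2024, Thm. 3.2] -/
theorem markerDominanceAvoid (w : Sym2 V → unitInterval) (s y z : V) (X : Set V) (hsy : s ≠ y)
    (F : Set (Sym2 V) → ℝ) (hF : Monotone F) :
    (prodBernoulli w).real ({ω : BondConfig V | ∀ x ∈ insert s X, ¬ (openGraph ω).Reachable y x} ∩ openConn y z) *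
        ((prodBernoulli w).real {ω : BondConfig V | ∀ x ∈ X, ¬ (openGraph ω).Reachable s x} *
            (∫ ω in {ω : BondConfig V | ∀ x ∈ X, ¬ (openGraph ω).Reachable s x} ∩ openConn s y,
              F (openEdgeCluster ω s) ∂(prodBernoulli w)) -
          (∫ ω in {ω : BondConfig V | ∀ x ∈ X, ¬ (openGraph ω).Reachable s x},
              F (openEdgeCluster ω s) ∂(prodBernoulli w)) *
            (prodBernoulli w).real ({ω : BondConfig V | ∀ x ∈ X, ¬ (openGraph ω).Reachable s x} ∩ openConn s y)) ≤
      (prodBernoulli w).real {ω : BondConfig V | ∀ x ∈ insert s X, ¬ (openGraph ω).Reachable y x} *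
        ((prodBernoulli w).real {ω : BondConfig V | ∀ x ∈ X, ¬ (openGraph ω).Reachable s x} *
            (∫ ω in {ω : BondConfig V | ∀ x ∈ X, ¬ (openGraph ω).Reachable s x} ∩ openConn s z,
              F (openEdgeCluster ω s) ∂(prodBernoulli w)) -
          (∫ ω in {ω : BondConfig V | ∀ x ∈ X, ¬ (openGraph ω).Reachable s x},
              F (openEdgeCluster ω s) ∂(prodBernoulli w)) *
            (prodBernoulli w).real ({ω : BondConfig V | ∀ x ∈ X, ¬ (openGraph ω).Reachable s x} ∩ openConn s z)) :=
  HullPort.markerDominanceAvoid_of_TA w s y z X hsy (ta_nonneg s y z X hsy) F hF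

/-- **COV(τ), unconditionally** (owner `x`, avoided vertex `y`, observers `o`, `v ≠ x`, `f` monotone on the open edge cluster of
`x`): `E · cov_D(f, 1_{x↔v}) ≤ M · cov_D(f, 1_{x↔o})`, `D = {x ↮ y}`, `E = μ(v ↮ x, v ↮ y, v ↔ o)`, `M = μ(v ↮ x, v ↮ y)` —
verbatim the conclusion of `CovTau.covTau_of_diagonal`, obtained from `markerDominanceAvoid` at `(s, X, y, z) := (x, {y}, v, o)`.
[cite: VandenbergHaggstromKahn2005, Thms. 1.3–1.4 (pp. 6–7), §2.1 (pp. 9–13)] [cite: Gladkov2024, Thm. 3.2] -/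
theorem covTau (w : Sym2 V → unitInterval) (x y o v : V) (hvx : v ≠ x)
    (f : Set (Sym2 V) → ℝ) (hf : Monotone f) :
    (prodBernoulli w).real ({ω : BondConfig V | ¬ (openGraph ω).Reachable v x} ∩
          {ω | ¬ (openGraph ω).Reachable v y} ∩ openConn v o) *
        ((prodBernoulli w).real {ω : BondConfig V | ¬ (openGraph ω).Reachable x y} *
            (∫ ω in {ω : BondConfig V | ¬ (openGraph ω).Reachable x y} ∩ openConn x v,
              f (openEdgeCluster ω x) ∂(prodBernoulli w)) -
          (∫ ω in {ω : BondConfig V | ¬ (openGraph ω).Reachable x y},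
              f (openEdgeCluster ω x) ∂(prodBernoulli w)) *
            (prodBernoulli w).real ({ω : BondConfig V | ¬ (openGraph ω).Reachable x y} ∩ openConn x v)) ≤
      (prodBernoulli w).real ({ω : BondConfig V | ¬ (openGraph ω).Reachable v x} ∩
          {ω | ¬ (openGraph ω).Reachable v y}) *
        ((prodBernoulli w).real {ω : BondConfig V | ¬ (openGraph ω).Reachable x y} *
            (∫ ω in {ω : BondConfig V | ¬ (openGraph ω).Reachable x y} ∩ openConn x o,
              f (openEdgeCluster ω x) ∂(prodBernoulli w)) -
          (∫ ω in {ω : BondConfig V | ¬ (openGraph ω).Reachable x y},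
              f (openEdgeCluster ω x) ∂(prodBernoulli w)) *
            (prodBernoulli w).real ({ω : BondConfig V | ¬ (openGraph ω).Reachable x y} ∩ openConn x o)) := by
  have h := markerDominanceAvoid w x v o ({y} : Set V) hvx.symm f hf
  have e1 : {ω : BondConfig V | ∀ x' ∈ ({y} : Set V), ¬ (openGraph ω).Reachable x x'} =
      {ω : BondConfig V | ¬ (openGraph ω).Reachable x y} := by
    ext ω
    simp only [mem_setOf_eq, mem_singleton_iff, forall_eq]
  have e2 : {ω : BondConfig V | ∀ x' ∈ insert x ({y} : Set V), ¬ (openGraph ω).Reachable v x'} =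
      {ω : BondConfig V | ¬ (openGraph ω).Reachable v x} ∩ {ω | ¬ (openGraph ω).Reachable v y} := by
    ext ω
    simp only [mem_setOf_eq, mem_inter_iff, mem_insert_iff, mem_singleton_iff, forall_eq_or_imp, forall_eq]
  rw [e1, e2] at h
  exact h

/-- **COV(τ) for the Kozma–Nitzan functional `F(C(b)) − F(C(a))`, unconditionally** (the hypothesis `hCOV` of
`SurplusTransfer.surplusTransfer_pair_of_covTransfer`): `CovTau.covTransfer_of_covTau` applied to `covTau` for the projected
functional of `CovTau.monotone_projFun`. [cite: VandenbergHaggstromKahn2005, §2.1 Lemma 2.4 (p. 10)] [cite: KozmaNitzan2024, Conj. 4 (p. 32)] -/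
theorem covTransfer (w : Sym2 V → unitInterval) (o v a b : V) (hvb : v ≠ b)
    (F : Set V → ℝ) (hF : ∀ S T : Set V, S ⊆ T → F S ≤ F T) :
    (prodBernoulli w).real (({ω : BondConfig V | ¬ (openGraph ω).Reachable v a} ∩ {ω | ¬ (openGraph ω).Reachable v b}) ∩
              openConn o v) *
        ((prodBernoulli w).real ((openConn a b)ᶜ : Set (BondConfig V)) *
            ∫ ω in (openConn v b ∩ (openConn a b)ᶜ : Set (BondConfig V)), (F (openCluster ω b) - F (openCluster ω a)) ∂(prodBernoulli w) -
          (prodBernoulli w).real (openConn v b ∩ (openConn a b)ᶜ : Set (BondConfig V)) *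
            ∫ ω in ((openConn a b)ᶜ : Set (BondConfig V)), (F (openCluster ω b) - F (openCluster ω a)) ∂(prodBernoulli w)) ≤
      (prodBernoulli w).real ({ω : BondConfig V | ¬ (openGraph ω).Reachable v a} ∩ {ω | ¬ (openGraph ω).Reachable v b}) *
        ((prodBernoulli w).real ((openConn a b)ᶜ : Set (BondConfig V)) *
            ∫ ω in (openConn o b ∩ (openConn a b)ᶜ : Set (BondConfig V)), (F (openCluster ω b) - F (openCluster ω a)) ∂(prodBernoulli w) -
          (prodBernoulli w).real (openConn o b ∩ (openConn a b)ᶜ : Set (BondConfig V)) *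
            ∫ ω in ((openConn a b)ᶜ : Set (BondConfig V)), (F (openCluster ω b) - F (openCluster ω a)) ∂(prodBernoulli w)) :=
  covTransfer_of_covTau w o v a b F (covTau w b a o v hvb _ (monotone_projFun w a b F hF))

/-- **(S5)₂ — the pair surplus transfer — unconditionally**: for `F` monotone nonnegative on vertex sets, relays `a, b` with
`m_a ≤ m_b` and observers `o`, `v ≠ a, b`: `μ(D ∩ {o↔v}) · Sur_v ≤ μ(D) · Sur_o` (`D = {v↮a} ∩ {v↮b}`,
`Sur_x = ∫_{x↔a ∨ x↔b} F(C(x)) − (μ(x↔a)·m_a + μ(x↔b, x↮a)·m_b)`).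
[cite: VandenbergHaggstromKahn2005, Thms. 1.3–1.5 (pp. 6–8)] [cite: KozmaNitzan2024, Conj. 4 (p. 32)] -/
theorem surplusTransfer_pair (w : Sym2 V → unitInterval) (o v a b : V) (hva : v ≠ a) (hvb : v ≠ b)
    (F : Set V → ℝ) (hF : ∀ S T : Set V, S ⊆ T → F S ≤ F T) (hF0 : ∀ S, 0 ≤ F S)
    (hmab : ∫ ω, F (openCluster ω a) ∂(prodBernoulli w) ≤ ∫ ω, F (openCluster ω b) ∂(prodBernoulli w)) :
    (prodBernoulli w).real ({ω : BondConfig V | ¬ (openGraph ω).Reachable v a} ∩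
          {ω : BondConfig V | ¬ (openGraph ω).Reachable v b} ∩ openConn o v) *
        (∫ ω in (openConn v a ∪ openConn v b), F (openCluster ω v) ∂(prodBernoulli w) -
          ((prodBernoulli w).real (openConn v a) * ∫ ω, F (openCluster ω a) ∂(prodBernoulli w) +
            (prodBernoulli w).real (openConn v b ∩ (openConn v a)ᶜ : Set (BondConfig V)) *
              ∫ ω, F (openCluster ω b) ∂(prodBernoulli w))) ≤
      (prodBernoulli w).real ({ω : BondConfig V | ¬ (openGraph ω).Reachable v a} ∩
          {ω : BondConfig V | ¬ (openGraph ω).Reachable v b}) *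
        (∫ ω in (openConn o a ∪ openConn o b), F (openCluster ω o) ∂(prodBernoulli w) -
          ((prodBernoulli w).real (openConn o a) * ∫ ω, F (openCluster ω a) ∂(prodBernoulli w) +
            (prodBernoulli w).real (openConn o b ∩ (openConn o a)ᶜ : Set (BondConfig V)) *
              ∫ ω, F (openCluster ω b) ∂(prodBernoulli w))) :=
  SurplusTransfer.surplusTransfer_pair_of_covTransfer w o v a b hva hvb F hF hF0 hmab
    (covTransfer w o v a b hvb F hF)

/-- **(GEN) for three relays, unconditionally**: for `F` monotone nonnegative on vertex sets, an observer `o`, relays with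
`m₁ ≤ m₂ ≤ m₃`, `a₃ ≠ a₁, a₂`:
`μ(o↔a₁)·m₁ + μ(o↔a₂, o↮a₁)·m₂ + μ(o↔a₃, o↮a₁, o↮a₂)·m₃ ≤ ∫_{o ↔ {a₁,a₂,a₃}} F(C(o))`.
[cite: KozmaNitzan2024, Conj. 4 (p. 32)] [cite: VandenbergHaggstromKahn2005, Thms. 1.3–1.5 (pp. 6–8)] -/
theorem gen_triple (w : Sym2 V → unitInterval) (o a₁ a₂ a₃ : V) (h31 : a₃ ≠ a₁) (h32 : a₃ ≠ a₂)
    (F : Set V → ℝ) (hF : ∀ S T : Set V, S ⊆ T → F S ≤ F T) (hF0 : ∀ S, 0 ≤ F S)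
    (hm12 : ∫ ω, F (openCluster ω a₁) ∂(prodBernoulli w) ≤ ∫ ω, F (openCluster ω a₂) ∂(prodBernoulli w))
    (hm23 : ∫ ω, F (openCluster ω a₂) ∂(prodBernoulli w) ≤ ∫ ω, F (openCluster ω a₃) ∂(prodBernoulli w)) :
    (prodBernoulli w).real (openConn o a₁) * ∫ ω, F (openCluster ω a₁) ∂(prodBernoulli w) +
        (prodBernoulli w).real (openConn o a₂ ∩ (openConn o a₁)ᶜ : Set (BondConfig V)) *
          ∫ ω, F (openCluster ω a₂) ∂(prodBernoulli w) +
        (prodBernoulli w).real (openConn o a₃ ∩ (openConn o a₁ ∪ openConn o a₂)ᶜ : Set (BondConfig V)) *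
          ∫ ω, F (openCluster ω a₃) ∂(prodBernoulli w) ≤
      ∫ ω in (openConn o a₁ ∪ openConn o a₂ ∪ openConn o a₃), F (openCluster ω o) ∂(prodBernoulli w) :=
  SurplusTransfer.gen_triple_of_covTransfer w o a₁ a₂ a₃ h31 h32 F hF hF0 hm12 hm23
    (covTransfer w o a₃ a₁ a₂ h32 F hF)

/-- **Kozma–Nitzan's Conjecture 1 for three relays, unconditionally** (relays ordered
`μ(a₁↔b') ≤ μ(a₂↔b') ≤ μ(a₃↔b')`, `a₃ ≠ a₁, a₂`): if `t ≤ μ(a_i ↔ b')` for all `i` then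
`t · μ(o ↔ {a₁,a₂,a₃}) ≤ μ(o ↔ b')`.  Proof: `gen_triple` at `F = 1{b' ∈ ·}` (bookkeeping, verbatim as in
`CovTau.kn_conj1_three_of_diagonal`). [cite: KozmaNitzan2024, Conj. 1 (p. 3)] -/
theorem kn_conj1_three (w : Sym2 V → unitInterval) (o b' a₁ a₂ a₃ : V) (h31 : a₃ ≠ a₁) (h32 : a₃ ≠ a₂)
    (hm12 : (prodBernoulli w).real (openConn a₁ b') ≤ (prodBernoulli w).real (openConn a₂ b'))
    (hm23 : (prodBernoulli w).real (openConn a₂ b') ≤ (prodBernoulli w).real (openConn a₃ b'))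
    (t : ℝ) (ht1 : t ≤ (prodBernoulli w).real (openConn a₁ b')) :
    t * (prodBernoulli w).real (openConn o a₁ ∪ openConn o a₂ ∪ openConn o a₃ : Set (BondConfig V)) ≤
      (prodBernoulli w).real (openConn o b') := by
  classical
  set μ := prodBernoulli w with hμ
  have hmeas : ∀ S : Set (BondConfig V), MeasurableSet S := fun _ => MeasurableSet.of_discrete
  have hn := fun (S : Set (BondConfig V)) => (measureReal_nonneg : 0 ≤ μ.real S)
  -- the set function `F = 1{b' ∈ ·}`
  set F : Set V → ℝ := fun M => if b' ∈ M then 1 else 0 with hF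
  have hFmono : ∀ S T : Set V, S ⊆ T → F S ≤ F T := by
    intro S T hST
    simp only [hF]
    by_cases hS : b' ∈ S
    · rw [if_pos hS, if_pos (hST hS)]
    · rw [if_neg hS]
      split_ifs <;> norm_num
  have hF0 : ∀ S, 0 ≤ F S := by
    intro S
    simp only [hF]
    split_ifs <;> norm_num
  have hFind : ∀ x : V, (fun ω : BondConfig V => F (openCluster ω x)) =
      (openConn x b' : Set (BondConfig V)).indicator 1 := by
    intro x
    funext ω
    simp only [hF]
    by_cases hω : ω ∈ (openConn x b' : Set (BondConfig V))
    · rw [Set.indicator_of_mem hω, Pi.one_apply, if_pos (show b' ∈ openCluster ω x from hω)]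
    · rw [Set.indicator_of_notMem hω, if_neg (show b' ∉ openCluster ω x from hω)]
  have hint : ∀ x : V, ∫ ω, F (openCluster ω x) ∂μ = μ.real (openConn x b') := by
    intro x
    rw [hFind x, integral_indicator_one (hmeas _)]
  have hsetint : ∀ (x : V) (S : Set (BondConfig V)),
      ∫ ω in S, F (openCluster ω x) ∂μ = μ.real (S ∩ openConn x b' : Set (BondConfig V)) := by
    intro x S
    rw [hFind x, ← integral_indicator (hmeas _), Set.indicator_indicator,
      integral_indicator_one ((hmeas _).inter (hmeas _))]
  have key := gen_triple w o a₁ a₂ a₃ h31 h32 F hFmono hF0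
    (by rw [hint, hint]; exact hm12) (by rw [hint, hint]; exact hm23)
  rw [hint, hint, hint, hsetint] at key
  -- `Σ μ(P_i) = μ(U)` and `t ≤ m_i`
  set U : Set (BondConfig V) := openConn o a₁ ∪ openConn o a₂ ∪ openConn o a₃ with hU
  have hP : μ.real U = μ.real (openConn o a₁) + μ.real (openConn o a₂ ∩ (openConn o a₁)ᶜ : Set (BondConfig V)) +
      μ.real (openConn o a₃ ∩ (openConn o a₁ ∪ openConn o a₂)ᶜ : Set (BondConfig V)) := by
    have h1 : μ.real U = μ.real (U ∩ (openConn o a₁ ∪ openConn o a₂)) +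
        μ.real (U \ (openConn o a₁ ∪ openConn o a₂)) :=
      (measureReal_inter_add_sdiff (s := U) (h := measure_ne_top _ _) ((hmeas _).union (hmeas _))).symm
    have h2 : μ.real (openConn o a₁ ∪ openConn o a₂ : Set (BondConfig V)) =
        μ.real ((openConn o a₁ ∪ openConn o a₂ : Set (BondConfig V)) ∩ openConn o a₁) +
          μ.real ((openConn o a₁ ∪ openConn o a₂ : Set (BondConfig V)) \ openConn o a₁) :=
      (measureReal_inter_add_sdiff (s := (openConn o a₁ ∪ openConn o a₂ : Set (BondConfig V)))
        (h := measure_ne_top _ _) (hmeas _)).symm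
    rw [inter_eq_right.2 subset_union_left, hU, Set.union_sdiff_left, Set.sdiff_eq] at h1
    rw [inter_eq_right.2 subset_union_left, Set.union_sdiff_left, Set.sdiff_eq] at h2
    rw [hU, h1, h2]
  have ht2 : t ≤ μ.real (openConn a₂ b') := ht1.trans hm12
  have ht3 : t ≤ μ.real (openConn a₃ b') := ht2.trans hm23
  have hmono : μ.real (U ∩ openConn o b' : Set (BondConfig V)) ≤ μ.real (openConn o b') :=
    measureReal_mono inter_subset_right (measure_ne_top _ _)
  rw [hP]
  nlinarith [key, hmono, hn (openConn o a₁), hn (openConn o a₂ ∩ (openConn o a₁)ᶜ),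
    hn (openConn o a₃ ∩ (openConn o a₁ ∪ openConn o a₂)ᶜ),
    mul_le_mul_of_nonneg_right ht1 (hn (openConn o a₁)),
    mul_le_mul_of_nonneg_right ht2 (hn (openConn o a₂ ∩ (openConn o a₁)ᶜ)),
    mul_le_mul_of_nonneg_right ht3 (hn (openConn o a₃ ∩ (openConn o a₁ ∪ openConn o a₂)ᶜ))]

end CovTau

end Summit.CriticalPhenomena.PercolationContinuityZ3.Theorems

end
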